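import Summits.QuantumFields.YangMills.Theorems.BalabanUVNodesN15KingModelBoundaryConditionSandwich
import HarnessLib

/-!
# BalabanUVNodes ∕ N15 — THE KING-MODEL RUNG (PART Ϟ-r): MONOTONICITY UNDER REFINEMENT OF THE PERIOD LATTICE — `K_μ ∣ K′_μ ⇒ f_{T(K)} ≤ f_{T(K′)} (≤ f_∞)` AND
# `G_{T(K′)}(x′,x′) ≤ G_{T(K)}(x,x)` (the periodic free energy densities INCREASE and the periodic variances DECREASE along every chain of period lattices `Kℤ ⊃ K′ℤ ⊃ …`, in
# particular along the doublings `K, 2K, 4K, …` of the block-spin iteration) (Track A, DAG node N15 = NE2; FAN-OUT v1.1 §N15 s3 «KING-MODEL RUNG»; King (3.89)∕(4.4), §4 p.670; count-neutral)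

HONEST FRAMING.  Count-neutral (cell `pub-ymgap`, seat `pub-ymgap-dag-n15-e` g41; `--supports stmt-QuantumFields-27366 --as helper` = K3⁸).  TEMPLATE LITERATURE: C. King, Commun. Math.
Phys. **102** (1986) 649–677 [King1986]: (2.17) p.653, (3.89)–(3.93) pp.668–669, (4.4) p.670, §4 p.670 l.8–13 («relating G on the torus to G on the whole lattice in the usual way»);
T. Bałaban, Commun. Math. Phys. **89** (1983) 571–597 [Balaban1983RegularityDecay]: (2.43) p.584.  By Poisson summation (part Ϟ-n) `f_{T(K)} = Σ_{m∈ℤ^{d+1}} Re ĥ(Km)` and (part Ε-b)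
`G_{T(K)}(x,y) = Σ_m K_∞(x̃−ỹ+Km)`; part Ϟ-p: `Re ĥ(z) ≤ 0` off the origin; part Ε-f: `K_∞ ≥ 0`.  When `K_μ ∣ K′_μ` the lattice `K′ℤ^{d+1}` is a sub-lattice of `Kℤ^{d+1}`, so the `K′`-sums are
SUB-SUMS of the `K`-sums and the omitted terms have a sign.  THIS FILE: §1 ★ `log_det_lapF_div_card_eq_tsum_re` (`|T(K)|⁻¹ln det(c(−Δ)+m²)_{T(K)} = Σ_m Re ĥ(Km)`, the real form of Ϟ-n's
Poisson identity), `summable_logKerC_translate`; §2 `periodRefineMap_injective`, `translate_eq_translate_refine` (the sub-lattice embedding `m ↦ (K′_μ∕K_μ·m_μ)_μ`), ★★★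
**`log_det_lapF_div_card_mono_of_dvd`** (`K ∣ K′ ⇒ f_{T(K)} ≤ f_{T(K′)}`), ★★ `log_det_lapF_div_card_le_double` (`f_{T(K)} ≤ f_{T(2K)}`), ★★ `log_det_lapF_div_card_pow_mono` (`a ↦ f_{T(2^aK)}` is
monotone); §3 ★★★ **`tsum_freeKer_translate_anti_of_dvd`** (`K ∣ K′ ⇒ Σ_mK_∞(w+K′m) ≤ Σ_mK_∞(w+Km)` for every `w`), ★★ **`lapF_inv_diag_anti_of_dvd`** (`G_{T(K′)}(x′,x′) ≤ G_{T(K)}(x,x)`),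
★★ `lapF_inv_diag_double_le`, ★★ `lapF_inv_diag_pow_anti` (`a ↦ G_{T(2^aK)}(0,0)` is antitone); §4 ★★★ **`king_period_refinement_monotone`** (by name, with the limits `f_∞` and `K_∞(0)` as
the respective bounds from parts Ϟ-q).

PRIOR TREE ART (named, USED not restated): Ϟ-n (`logKerC`, `norm_logKerC_le`, `logSymC_ofRealVec`, `torusMean_logSymC_eq_tsum`, `sum_kingLogSym_dualMomentum_eq`), Ϟ-p (`logKerC_re_nonpos`),
Ϟ-q (`log_det_lapF_div_card_le_freeEnergyInf`, `freeKer_zero_le_lapF_inv_diag`), Ε-b (`lapF_inv_eq_tsum_freeKer`, `summable_freeKer_translate`, `torRepZ`), Ε-f (`freeKer_nonneg`), Ε-k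
(`log_det_lapF`), Ε-m (`kingFreeEnergyInf`; the thermodynamic limit itself is Ε-m's `tendsto_log_det_lapF_div_card`, not repeated), pv17 `B4TorusKernel` (`summable_of_decay`,
`MultiPeriod.translate`, `translate_injective`), `B4TorusGreen244` (`dualMomentum`), `King1986` (`lapF`, `Tor`), Mathlib `Summable.tsum_le_tsum_of_inj`.  NOT Bałaban's covariant objects;
NOT a node discharge (N15 is booked through n15-a's knit, untouched); nothing continuum-YM ∕ `ℝ⁴` ∕ OS ∕ Clay.  0 `sorry`; 0 `def`.

HONEST SCOPE.  King's `A = 0` free operator, `c ≥ 0`, `m² > 0`, period vectors with `K_μ ∣ K′_μ` for every `μ` (componentwise divisibility; no statement for incomparable period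
vectors, where neither inequality holds in general); the comparisons are ONE-SIDED, strictness not claimed.  Locators: [King1986] (2.17) p.653, (3.89)–(3.93) pp.668–669, (4.4)
p.670, §4 p.670 l.8–13; [Balaban1983RegularityDecay] (2.43) p.584.
-/

noncomputable section

open scoped BigOperators
open Finset Complex

namespace Summit.QuantumFields.YangMills.BalabanUVNodes.N15KingModelRung.TorusSpectral

open Literature.MathematicalPhysics.QuantumFieldTheory.Balaban1983to89.B5Prop11Plancherel (Tor)
open Literature.MathematicalPhysics.QuantumFieldTheory.Balaban1983to89.B4Strip (ofRealVec)
open Literature.MathematicalPhysics.QuantumFieldTheory.Balaban1983to89.B4TorusKernel (summable_of_decay)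
open Literature.MathematicalPhysics.QuantumFieldTheory.Balaban1983to89.B4TorusKernel.MultiPeriod (translate translate_apply translate_injective)
open Literature.MathematicalPhysics.QuantumFieldTheory.Balaban1983to89.B4TorusGreen244 (dualMomentum)
open Literature.MathematicalPhysics.QuantumFieldTheory.King1986.Torus

variable {d : ℕ} {c m2 : ℝ}

/-! ## §1 The periodic free energy density as a lattice sum -/

section Density

/-- the Poisson series of the log-kernel along `Kℤ^{d+1}` is summable. [cite: Balaban1983RegularityDecay, (2.43) p.584] -/
theorem summable_logKerC_translate (K : Fin (d + 1) → ℕ) [hK : ∀ i, NeZero (K i)] (hc : 0 ≤ c) (hm : 0 < m2) :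
    Summable fun m : Fin (d + 1) → ℤ => logKerC c m2 (translate K 0 m) :=
  (summable_of_decay (logKerC c m2) (kappaFree_pos hc hm d) (norm_logKerC_le hc hm)).comp_injective (translate_injective (fun _ => NeZero.one_le) 0)

/-- ★ **`|T(K)|⁻¹·ln det(c(−Δ)+m²)_{Πℤ∕K_μ} = Σ_{m∈ℤ^{d+1}} Re ĥ(Km)`** — the real form of part Ϟ-n's Poisson identity. [cite: King1986, (3.89) p.668, (4.4) p.670;
Balaban1983RegularityDecay, (2.43) p.584] -/
theorem log_det_lapF_div_card_eq_tsum_re (K : Fin (d + 1) → ℕ) [hK : ∀ i, NeZero (K i)] (hc : 0 ≤ c) (hm : 0 < m2) :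
    (Fintype.card (Tor K) : ℝ)⁻¹ * Real.log (lapF K c m2).det = ∑' m : Fin (d + 1) → ℤ, (logKerC c m2 (translate K 0 m)).re := by
  have hK1 : ∀ i, 1 ≤ K i := fun i => NeZero.one_le
  have hcard : (Fintype.card (Tor K) : ℝ) = ∏ i, (K i : ℝ) := by
    rw [Fintype.card_pi]; push_cast; simp [ZMod.card]
  have hre : (Fintype.card (Tor K) : ℝ)⁻¹ * Real.log (lapF K c m2).det
      = ((∏ i, ((K i : ℕ) : ℂ))⁻¹ * ∑ k : (i : Fin (d + 1)) → Fin (K i), logSymC c m2 (ofRealVec (dualMomentum K k))).re := by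
    rw [log_det_lapF K hc hm, ← sum_kingLogSym_dualMomentum_eq K c m2, hcard]
    simp_rw [logSymC_ofRealVec hc hm]
    rw [← Complex.ofReal_sum]
    have e : (∏ i, ((K i : ℕ) : ℂ))⁻¹ = (((∏ i, (K i : ℝ))⁻¹ : ℝ) : ℂ) := by push_cast; rfl
    rw [e, ← Complex.ofReal_mul, Complex.ofReal_re]
  rw [hre, torusMean_logSymC_eq_tsum K hc hm hK1, Complex.re_tsum (summable_logKerC_translate K hc hm)]

end Density

/-! ## §2 Refining the period lattice increases the free energy density -/

section Refine

/-- the sub-lattice embedding `m ↦ (q_μ m_μ)_μ` is injective for `q_μ ≠ 0`. [folklore] -/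
theorem periodRefineMap_injective {q : Fin (d + 1) → ℕ} (hq : ∀ i, q i ≠ 0) : Function.Injective (fun m : Fin (d + 1) → ℤ => fun i => (q i : ℤ) * m i) := by
  intro m m' h
  funext i
  have hi := congrFun h i
  have hqi : (q i : ℤ) ≠ 0 := by exact_mod_cast hq i
  exact mul_left_cancel₀ hqi hi

/-- `K′m = K(qm)` when `K′_μ = K_μq_μ`. [folklore] -/
theorem translate_eq_translate_refine {K K' q : Fin (d + 1) → ℕ} (hq : ∀ i, K' i = K i * q i) (w m : Fin (d + 1) → ℤ) :
    translate K' w m = translate K w (fun i => (q i : ℤ) * m i) := by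
  funext i
  simp only [translate_apply, hq i]
  push_cast
  ring

/-- ★★★ **REFINING THE PERIOD LATTICE INCREASES THE FREE ENERGY DENSITY**: `K_μ ∣ K′_μ` for all `μ` ⇒ `|T(K)|⁻¹ln det(c(−Δ)+m²)_{T(K)} ≤ |T(K′)|⁻¹ln det(c(−Δ)+m²)_{T(K′)}` (the `K′`-Poisson
sum is the sub-sum of the `K`-Poisson sum over `qℤ^{d+1}`, and the omitted terms `Re ĥ(Km)`, `m ≠ 0`, are `≤ 0` by part Ϟ-p). [cite: King1986, (3.89)–(3.93) pp.668–669, (4.4) p.670] -/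
theorem log_det_lapF_div_card_mono_of_dvd (K K' : Fin (d + 1) → ℕ) [hK : ∀ i, NeZero (K i)] [hK' : ∀ i, NeZero (K' i)] (hdvd : ∀ i, K i ∣ K' i) (hc : 0 ≤ c) (hm : 0 < m2) :
    (Fintype.card (Tor K) : ℝ)⁻¹ * Real.log (lapF K c m2).det ≤ (Fintype.card (Tor K') : ℝ)⁻¹ * Real.log (lapF K' c m2).det := by
  have hK1 : ∀ i, 1 ≤ K i := fun i => NeZero.one_le
  have hq : ∀ i, K' i = K i * (K' i / K i) := fun i => (Nat.mul_div_cancel' (hdvd i)).symm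
  have hq0 : ∀ i, K' i / K i ≠ 0 := fun i h => NeZero.ne (K' i) (by rw [hq i, h, mul_zero])
  have he := periodRefineMap_injective hq0
  have hsK := (Complex.hasSum_re (summable_logKerC_translate K hc hm).hasSum).summable
  have hsK' := (Complex.hasSum_re (summable_logKerC_translate K' hc hm).hasSum).summable
  rw [log_det_lapF_div_card_eq_tsum_re K hc hm, log_det_lapF_div_card_eq_tsum_re K' hc hm, ← neg_le_neg_iff, ← tsum_neg, ← tsum_neg]
  refine Summable.tsum_le_tsum_of_inj (f := fun m => -(logKerC c m2 (translate K' 0 m)).re) (g := fun m => -(logKerC c m2 (translate K 0 m)).re)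
    (fun m : Fin (d + 1) → ℤ => fun i => ((K' i / K i : ℕ) : ℤ) * m i) he (fun m hm0 => ?_) (fun m => ?_) hsK'.neg hsK.neg
  · have hne : translate K 0 m ≠ 0 := by
      intro h0
      apply hm0
      refine ⟨0, ?_⟩
      have : m = 0 := translate_injective hK1 0 (h0.trans (by funext i; simp))
      rw [this]
      funext i
      simp
    exact neg_nonneg.mpr (logKerC_re_nonpos hc hm hne)
  · rw [translate_eq_translate_refine hq]

/-- ★★ **DOUBLING THE TORUS INCREASES THE FREE ENERGY DENSITY**: `f_{T(K)} ≤ f_{T(2K)}`. [cite: King1986, (3.89)–(3.93) pp.668–669] -/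
theorem log_det_lapF_div_card_le_double (K : Fin (d + 1) → ℕ) [hK : ∀ i, NeZero (K i)] (hc : 0 ≤ c) (hm : 0 < m2) :
    (Fintype.card (Tor K) : ℝ)⁻¹ * Real.log (lapF K c m2).det
      ≤ (Fintype.card (Tor (fun i => 2 * K i)) : ℝ)⁻¹ * Real.log (lapF (fun i => 2 * K i) c m2).det :=
  log_det_lapF_div_card_mono_of_dvd K (fun i => 2 * K i) (fun _ => Dvd.intro_left 2 rfl) hc hm

/-- ★★ **ALONG THE DOUBLINGS `K, 2K, 4K, …` THE FREE ENERGY DENSITY IS MONOTONE** (and bounded by `f_∞`, part Ϟ-q; it converges to `f_∞` by part Ε-m). [cite: King1986, (3.89)–(3.93) pp.668–669] -/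
theorem log_det_lapF_div_card_pow_mono (K : Fin (d + 1) → ℕ) [hK : ∀ i, NeZero (K i)] (hc : 0 ≤ c) (hm : 0 < m2) :
    Monotone fun a : ℕ => (Fintype.card (Tor (fun i => 2 ^ a * K i)) : ℝ)⁻¹ * Real.log (lapF (fun i => 2 ^ a * K i) c m2).det :=
  monotone_nat_of_le_succ fun a => by
    have h := log_det_lapF_div_card_mono_of_dvd (fun i => 2 ^ a * K i) (fun i => 2 ^ (a + 1) * K i)
      (fun i => mul_dvd_mul_right (pow_dvd_pow 2 (Nat.le_succ a)) (K i)) hc hm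
    exact h

end Refine

/-! ## §3 Refining the period lattice decreases the variances -/

section Variance

/-- ★★★ **REFINING THE PERIOD LATTICE DECREASES THE PERIODISED KERNEL**: `K_μ ∣ K′_μ ⇒ Σ_mK_∞(w+K′m) ≤ Σ_mK_∞(w+Km)` for every `w ∈ ℤ^{d+1}` (sub-sum of non-negative terms, Ε-f).
[cite: King1986, §4 p.670 l.8–13, (4.4) p.670; Balaban1983RegularityDecay, (2.43) p.584] -/
theorem tsum_freeKer_translate_anti_of_dvd (K K' : Fin (d + 1) → ℕ) [hK : ∀ i, NeZero (K i)] [hK' : ∀ i, NeZero (K' i)] (hdvd : ∀ i, K i ∣ K' i) (hc : 0 ≤ c) (hm : 0 < m2)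
    (w : Fin (d + 1) → ℤ) :
    ∑' m : Fin (d + 1) → ℤ, freeKer c m2 (translate K' w m) ≤ ∑' m : Fin (d + 1) → ℤ, freeKer c m2 (translate K w m) := by
  have hq : ∀ i, K' i = K i * (K' i / K i) := fun i => (Nat.mul_div_cancel' (hdvd i)).symm
  have hq0 : ∀ i, K' i / K i ≠ 0 := fun i h => NeZero.ne (K' i) (by rw [hq i, h, mul_zero])
  refine Summable.tsum_le_tsum_of_inj (fun m : Fin (d + 1) → ℤ => fun i => ((K' i / K i : ℕ) : ℤ) * m i) (periodRefineMap_injective hq0)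
    (fun m _ => freeKer_nonneg hc hm _) (fun m => ?_) (summable_freeKer_translate K' hc hm w) (summable_freeKer_translate K hc hm w)
  rw [translate_eq_translate_refine hq]

/-- ★★ **REFINING THE PERIOD LATTICE DECREASES EVERY VARIANCE**: `K_μ ∣ K′_μ ⇒ G_{T(K′)}(x′,x′) ≤ G_{T(K)}(x,x)` (all diagonal values of a torus covariance agree).
[cite: King1986, (2.17) p.653, §4 p.670 l.8–13] -/
theorem lapF_inv_diag_anti_of_dvd (K K' : Fin (d + 1) → ℕ) [hK : ∀ i, NeZero (K i)] [hK' : ∀ i, NeZero (K' i)] (hdvd : ∀ i, K i ∣ K' i) (hc : 0 ≤ c) (hm : 0 < m2)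
    (x : Tor K) (x' : Tor K') : (lapF K' c m2)⁻¹ x' x' ≤ (lapF K c m2)⁻¹ x x := by
  rw [lapF_inv_eq_tsum_freeKer K hc hm x x, lapF_inv_eq_tsum_freeKer K' hc hm x' x', sub_self, sub_self]
  exact tsum_freeKer_translate_anti_of_dvd K K' hdvd hc hm 0

/-- ★★ **DOUBLING THE TORUS DECREASES THE VARIANCE**: `G_{T(2K)}(0,0) ≤ G_{T(K)}(0,0)`. [cite: King1986, (2.17) p.653, §4 p.670 l.8–13] -/
theorem lapF_inv_diag_double_le (K : Fin (d + 1) → ℕ) [hK : ∀ i, NeZero (K i)] (hc : 0 ≤ c) (hm : 0 < m2) :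
    (lapF (fun i => 2 * K i) c m2)⁻¹ 0 0 ≤ (lapF K c m2)⁻¹ 0 0 :=
  lapF_inv_diag_anti_of_dvd K (fun i => 2 * K i) (fun _ => Dvd.intro_left 2 rfl) hc hm 0 0

/-- ★★ **ALONG THE DOUBLINGS THE VARIANCE IS ANTITONE** (and bounded below by `K_∞(0)`, part Ϟ-q; it converges to `K_∞(0)` by part Ε-f). [cite: King1986, (2.17) p.653, §4 p.670 l.8–13] -/
theorem lapF_inv_diag_pow_anti (K : Fin (d + 1) → ℕ) [hK : ∀ i, NeZero (K i)] (hc : 0 ≤ c) (hm : 0 < m2) :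
    Antitone fun a : ℕ => (lapF (fun i => 2 ^ a * K i) c m2)⁻¹ 0 0 :=
  antitone_nat_of_succ_le fun a =>
    lapF_inv_diag_anti_of_dvd (fun i => 2 ^ a * K i) (fun i => 2 ^ (a + 1) * K i) (fun i => mul_dvd_mul_right (pow_dvd_pow 2 (Nat.le_succ a)) (K i)) hc hm 0 0

end Variance

/-! ## §4 By name -/

section Package

/-- ★★★ **MONOTONICITY UNDER REFINEMENT, BY NAME**: for `K_μ ∣ K′_μ` (`c ≥ 0`, `m² > 0`): `f_{T(K)} ≤ f_{T(K′)} ≤ f_∞` and `K_∞(0) ≤ G_{T(K′)}(0,0) ≤ G_{T(K)}(0,0)`.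
[cite: King1986, (2.17) p.653, (3.89)–(3.93) pp.668–669, (4.4) p.670, §4 p.670 l.8–13] -/
theorem king_period_refinement_monotone (K K' : Fin (d + 1) → ℕ) [hK : ∀ i, NeZero (K i)] [hK' : ∀ i, NeZero (K' i)] (hdvd : ∀ i, K i ∣ K' i) (hc : 0 ≤ c) (hm : 0 < m2) :
    ((Fintype.card (Tor K) : ℝ)⁻¹ * Real.log (lapF K c m2).det ≤ (Fintype.card (Tor K') : ℝ)⁻¹ * Real.log (lapF K' c m2).det
      ∧ (Fintype.card (Tor K') : ℝ)⁻¹ * Real.log (lapF K' c m2).det ≤ kingFreeEnergyInf c m2 d)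
    ∧ (freeKer c m2 (0 : Fin (d + 1) → ℤ) ≤ (lapF K' c m2)⁻¹ 0 0 ∧ (lapF K' c m2)⁻¹ 0 0 ≤ (lapF K c m2)⁻¹ 0 0) :=
  ⟨⟨log_det_lapF_div_card_mono_of_dvd K K' hdvd hc hm, log_det_lapF_div_card_le_freeEnergyInf K' hc hm⟩,
    ⟨freeKer_zero_le_lapF_inv_diag K' hc hm 0, lapF_inv_diag_anti_of_dvd K K' hdvd hc hm 0 0⟩⟩

end Package

end Summit.QuantumFields.YangMills.BalabanUVNodes.N15KingModelRung.TorusSpectral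

end
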